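import Literature.AlgebraicGeometry.Modules.SheafHomExact
import HarnessLib

/-!
# Local frames of a finite locally free `𝒪_X`-module: dual basis, coordinates, and the
# contraction `𝓗om(E, 𝓗om(E^∨, G)) → G` in a frame

For an `𝒪_X`-module `E` on a scheme `X` trivialised over an open `W` by `e : 𝒪^I ≅ E|_W`
(`I` finite), with basis sections `b_i ∈ Γ(E, W)` (`basisSection`, `Modules/SheafHomExact.lean`):

* `smulSection b : 𝒪|_W → M|_W` (`r ↦ r b`), `dualBasis e i = λ_i ∈ Γ(E^∨, W)` (`λ_i(b_j) = δ_ij`,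
  `appLE_dualBasis_basisSection`), the coordinates `coord e k s i = λ_i(s) ∈ Γ(X, V)` of a section
  `s ∈ Γ(E, V)`, `V ≤ W`;
* the **basis expansions** `∑_i λ_i ≫ (· b_i) = 𝟙_{E|_W}` (`sum_dualBasis_comp_smulSection`),
  `χ(s) = ∑_i λ_i(s) χ(b_i)` (`appLE_eq_sum_coord`), `s = ∑_i λ_i(s) b_i` (`eq_sum_coord_smul`),
  `μ = ∑_i μ(b_i) λ_i` for `μ ∈ Γ(E^∨, W)` (`eq_sum_smul_dualBasis`);
* `dual E = 𝓗om(E, 𝒪_X) = E^∨` (Hartshorne II Ex. 5.1) and the **contraction in a frame**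
  `frameContract G e B = ∑_i B(b_i)(λ_i) ∈ Γ(G, W)` of `B ∈ Γ(𝓗om(E, 𝓗om(E^∨, G)), W)` — the map
  `E^∨ ⊗ E ⊗ G → G`, `λ ⊗ s ⊗ g ↦ λ(s) g`, through `𝓗om(E, 𝓗om(E^∨, G)) ≅ E^∨ ⊗ E ⊗ G`
  (Hartshorne II Ex. 5.1 (b)); it is additive and `𝒪(W)`-linear in `B`, **independent of the
  frame** (`frameContract_eq`: expand one basis in the other — the `tr(PQ) = tr(QP)` computation)
  and compatible with restriction to smaller opens (`map_frameContract`).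

`Modules/LocallyFreeTrace.lean` glues these into the contraction `𝓗om(E, 𝓗om(E^∨, G)) → G` and the
trace `𝓔nd(E) → 𝒪_X` of a finite locally free `E`. Everything is proved; no named facts.

## References

* R. Hartshorne, *Algebraic Geometry*, GTM 52 (1977): II.5 (p. 109), II Ex. 5.1 (p. 123)
  (held copy, PDF pp. 138, 156). [Hartshorne1977]
-/

noncomputable section

open CategoryTheory AlgebraicGeometry Opposite TopologicalSpace Limits

namespace Literature.AlgebraicGeometry.Modules

open Literature.AlgebraicGeometry.Motives

universe u

variable {X : Scheme.{u}}

/-! ### Local frames: dual basis, coordinates, expansions -/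

section Frames

open scoped Classical

variable {E M : X.Modules} {U W V : X.Opens} {I : Type u}

/-- `χ ↦ χ_W(s)` as an additive map (to evaluate finite sums of morphisms). [folklore] -/
def appLEHom (k : W ⟶ U) (s : Γ(E, W)) : (E.over U ⟶ M.over U) →+ Γ(M, W) where
  toFun χ := appLE χ k s
  map_zero' := appLE_zero k s
  map_add' χ χ' := appLE_add χ χ' k s

/-- Values of a finite sum of morphisms. [folklore] -/
lemma appLE_sum {ι : Type*} (t : Finset ι) (χ : ι → (E.over U ⟶ M.over U)) (k : W ⟶ U)
    (s : Γ(E, W)) : appLE (∑ i ∈ t, χ i) k s = ∑ i ∈ t, appLE (χ i) k s :=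
  map_sum (appLEHom k s) χ t

/-- `φ_W(∑ s_i) = ∑ φ_W(s_i)`. [folklore] -/
lemma appLE_sum_right {ι : Type*} (t : Finset ι) (χ : E.over U ⟶ M.over U) (k : W ⟶ U)
    (s : ι → Γ(E, W)) : appLE χ k (∑ i ∈ t, s i) = ∑ i ∈ t, appLE χ k (s i) :=
  map_sum (χ.val.app (op (Over.mk k))).hom s t

/-- **Multiplication by a section**: the morphism `𝒪_X|_W → E|_W`, `r ↦ r • b|` for `b ∈ Γ(E, W)`.
[folklore] -/
def smulSection (b : Γ(E, W)) : (unitModule X).over W ⟶ E.over W where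
  val := PresheafOfModules.homMk
    { app := fun V => AddCommGrpCat.ofHom
        { toFun := fun (r : Γ(X, V.unop.left)) =>
            (r • E.presheaf.map V.unop.hom.op b : Γ(E, V.unop.left))
          map_zero' := zero_smul _ (E.presheaf.map V.unop.hom.op b)
          map_add' := fun (r r' : Γ(X, V.unop.left)) =>
            add_smul r r' (E.presheaf.map V.unop.hom.op b) }
      naturality := fun {V V'} g => by
        refine AddCommGrpCat.ext fun (r : Γ(X, V.unop.left)) => ?_
        change ((X.presheaf.map g.unop.left.op r : Γ(X, V'.unop.left)) •
            E.presheaf.map V'.unop.hom.op b : Γ(E, V'.unop.left)) =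
          E.presheaf.map g.unop.left.op (r • E.presheaf.map V.unop.hom.op b)
        rw [Scheme.Modules.map_smul, presheaf_map_map]
        rfl }
    (fun V (a : Γ(X, V.unop.left)) (r : Γ(X, V.unop.left)) => by
      change ((a * r) • E.presheaf.map V.unop.hom.op b : Γ(E, V.unop.left)) =
        a • (r • E.presheaf.map V.unop.hom.op b)
      exact mul_smul a r _)

/-- Values of `smulSection b`: `r ↦ r • b|_V`. [folklore] -/
@[simp]
lemma appLE_smulSection (b : Γ(E, W)) (k : V ⟶ W) (r : Γ(X, V)) :
    appLE (smulSection b) k r = r • E.presheaf.map k.op b := rfl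

variable (e : SheafOfModules.free I ≅ E.over W)

/-- **The dual basis** `λ_i ∈ Γ(E^∨, W) = Hom(E|_W, 𝒪|_W)` of a trivialisation `e : 𝒪^I ≅ E|_W`:
`λ_i(b_j) = δ_{ij}`. [cite: Hartshorne1977, II Ex. 5.1] -/
def dualBasis (i : I) : E.over W ⟶ (unitModule X).over W :=
  homOfBasisValues e (fun j => if j = i then (1 : X.ringCatSheaf.obj.obj (op W)) else 0)

/-- `λ_i(b_j) = δ_{ij}`. [folklore] -/
lemma appLE_dualBasis_basisSection (i j : I) :
    appLE (dualBasis e i) (𝟙 W) (basisSection e j) =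
      (if j = i then (1 : X.ringCatSheaf.obj.obj (op W)) else 0) :=
  appLE_homOfBasisValues e _ j

/-- **The coordinates** `λ_i(s) ∈ Γ(X, V)` of a section `s ∈ Γ(E, V)`, `V ≤ W`, in the frame `e`.
[folklore] -/
def coord (k : V ⟶ W) (s : Γ(E, V)) (i : I) : Γ(X, V) :=
  (appLE (dualBasis e i) k s : Γ(unitModule X, V))

/-- Unfolding `coord`. [folklore] -/
lemma coord_def (k : V ⟶ W) (s : Γ(E, V)) (i : I) :
    coord e k s i = appLE (dualBasis e i) k s := rfl

/-- Coordinates of the basis sections: `λ_i(b_j) = δ_{ij}`. [folklore] -/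
lemma coord_basisSection (i j : I) :
    coord e (𝟙 W) (basisSection e j) i = if j = i then 1 else 0 := by
  rw [coord_def, appLE_dualBasis_basisSection]
  split_ifs <;> rfl

variable [Fintype I]

/-- **`∑_i λ_i(–) b_i = id`**: the basis expansion as an identity of endomorphisms of `E|_W`.
[folklore] -/
theorem sum_dualBasis_comp_smulSection :
    ∑ i, dualBasis e i ≫ smulSection (basisSection e i) = 𝟙 (E.over W) := by
  refine hom_ext_of_basisSection e fun j => ?_
  rw [appLE_sum, appLE_id]
  have h : ∀ i, appLE (dualBasis e i ≫ smulSection (basisSection e i)) (𝟙 W) (basisSection e j) =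
      (if j = i then (1 : Γ(X, W)) else 0) • basisSection e i := by
    intro i
    rw [appLE_comp, ← coord_def, appLE_smulSection, coord_basisSection, op_id, E.presheaf.map_id]
    rfl
  simp_rw [h, ite_smul, one_smul, zero_smul, Finset.sum_ite_eq, Finset.mem_univ, if_true]

/-- **Basis expansion of values**: `χ(s) = ∑_i λ_i(s) χ(b_i|)` for `χ : E|_W → M|_W` and a section
`s` of `E` over `V ≤ W`. [folklore] -/
theorem appLE_eq_sum_coord (χ : E.over W ⟶ M.over W) (k : V ⟶ W) (s : Γ(E, V)) :
    appLE χ k s = ∑ i, coord e k s i • appLE χ k (E.presheaf.map k.op (basisSection e i)) := by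
  conv_lhs => rw [← Category.id_comp χ, ← sum_dualBasis_comp_smulSection e, Preadditive.sum_comp,
    appLE_sum]
  refine Finset.sum_congr rfl fun i _ => ?_
  rw [Category.assoc, appLE_comp, appLE_comp, ← coord_def, appLE_smulSection, appLE_smul_right]

/-- **Basis expansion of sections**: `s = ∑_i λ_i(s) b_i|`. [folklore] -/
theorem eq_sum_coord_smul (k : V ⟶ W) (s : Γ(E, V)) :
    s = ∑ i, coord e k s i • E.presheaf.map k.op (basisSection e i) := by
  have h := appLE_eq_sum_coord e (𝟙 (E.over W)) k s
  simpa only [appLE_id] using h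

omit [Fintype I] in
/-- The coordinates `μ(b_i) ∈ Γ(X, W)` of `μ ∈ Γ(E^∨, W) = Hom(E|_W, 𝒪|_W)` in the dual basis.
[folklore] -/
def dualCoord (μ : E.over W ⟶ (unitModule X).over W) (i : I) : Γ(X, W) :=
  (appLE μ (𝟙 W) (basisSection e i) : Γ(unitModule X, W))

omit [Fintype I] in
/-- Unfolding `dualCoord`. [folklore] -/
lemma dualCoord_def (μ : E.over W ⟶ (unitModule X).over W) (i : I) :
    dualCoord e μ i = appLE μ (𝟙 W) (basisSection e i) := rfl

/-- **Dual basis expansion**: `μ = ∑_i μ(b_i) λ_i` for `μ ∈ Γ(E^∨, W) = Hom(E|_W, 𝒪|_W)`. [folklore] -/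
theorem eq_sum_smul_dualBasis (μ : E.over W ⟶ (unitModule X).over W) :
    μ = ∑ i, dualCoord e μ i • dualBasis e i := by
  refine hom_ext_of_basisSection e fun j => ?_
  rw [appLE_sum]
  have h : ∀ i, appLE (dualCoord e μ i • dualBasis e i) (𝟙 W) (basisSection e j) =
      if j = i then appLE μ (𝟙 W) (basisSection e i) else 0 := by
    intro i
    rw [appLE_smul, op_id, X.presheaf.map_id, ← coord_def, coord_basisSection]
    change dualCoord e μ i * _ = _
    rw [mul_ite, mul_one, mul_zero]
    rfl
  simp_rw [h, Finset.sum_ite_eq, Finset.mem_univ, if_true]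

end Frames

end Literature.AlgebraicGeometry.Modules

end

noncomputable section

open CategoryTheory AlgebraicGeometry Opposite TopologicalSpace Limits

namespace Literature.AlgebraicGeometry.Modules

open Literature.AlgebraicGeometry.Motives

universe u

variable {X : Scheme.{u}}

/-! ### The contraction `𝓗om(E, 𝓗om(E^∨, G)) → G` in a local frame -/

section FrameContract

open scoped Classical

/-- **The dual** `E^∨ = 𝓗om_{𝒪_X}(E, 𝒪_X)` of an `𝒪_X`-module. [cite: Hartshorne1977, II Ex. 5.1] -/
abbrev dual (E : X.Modules) : X.Modules := sheafHom E (unitModule X)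

variable {E : X.Modules} (G : X.Modules) {W V : X.Opens} {I I' : Type u}

/-- `E.map (𝟙 W) s = s`. [folklore] -/
lemma presheaf_map_id (E : X.Modules) (s : Γ(E, W)) : E.presheaf.map (𝟙 W).op s = s := by
  rw [op_id, E.presheaf.map_id]
  rfl

/-- `𝒪_X.map (𝟙 W) a = a`. [folklore] -/
lemma structurePresheaf_map_id (a : Γ(X, W)) : X.presheaf.map (𝟙 W).op a = a := by
  rw [op_id, X.presheaf.map_id]
  rfl

/-- `(a • Φ)(μ) = a • Φ(μ)` at the top open (no restriction of the scalar). [folklore] -/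
lemma appLE_smul_id {E M : X.Modules} (a : Γ(X, W)) (Φ : E.over W ⟶ M.over W) (s : Γ(E, W)) :
    appLE (a • Φ) (𝟙 W) s = a • appLE Φ (𝟙 W) s := by
  rw [appLE_smul, structurePresheaf_map_id]

variable (e : SheafOfModules.free I ≅ E.over W)

/-- Restricting the dual basis gives the dual basis of the restricted trivialisation. [folklore] -/
lemma restrictHom_dualBasis (k : V ⟶ W) (i : I) :
    restrictHom k (dualBasis e i) =
      dualBasis (SheafOfModules.restrictTrivialisation (R := X.ringCatSheaf) k e) i := by
  refine hom_ext_of_basisSection (SheafOfModules.restrictTrivialisation (R := X.ringCatSheaf) k e)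
    fun j => ?_
  rw [appLE_dualBasis_basisSection, appLE_restrictHom, basisSection_restrictTrivialisation,
    Subsingleton.elim (𝟙 V ≫ k) (k ≫ 𝟙 W), appLE_map, appLE_dualBasis_basisSection]
  change X.presheaf.map k.op (if j = i then (1 : Γ(X, W)) else 0) = _
  rw [apply_ite (X.presheaf.map k.op), map_one, map_zero]
  rfl

variable [Fintype I]

/-- **The contraction in a frame**: for `B ∈ Γ(𝓗om(E, 𝓗om(E^∨, G)), W) = Hom(E|_W, 𝓗om(E^∨, G)|_W)`
and a trivialisation `e` of `E|_W` with basis `b_i` and dual basis `λ_i`,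
`c_e(B) = ∑_i B(b_i)(λ_i) ∈ Γ(G, W)` (the image of `B` under `E^∨ ⊗ E ⊗ G → G`,
`λ ⊗ s ⊗ g ↦ λ(s) g`, computed in the frame). [cite: Hartshorne1977, II Ex. 5.1 (b)] -/
def frameContract (B : E.over W ⟶ (sheafHom (dual E) G).over W) : Γ(G, W) :=
  ∑ i, appLE (appLE B (𝟙 W) (basisSection e i) : (dual E).over W ⟶ G.over W) (𝟙 W)
    (dualBasis e i : E.over W ⟶ (unitModule X).over W)

/-- The contraction in a frame is additive in `B`. [folklore] -/
lemma frameContract_add (B B' : E.over W ⟶ (sheafHom (dual E) G).over W) :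
    frameContract G e (B + B') = frameContract G e B + frameContract G e B' := by
  unfold frameContract
  rw [← Finset.sum_add_distrib]
  refine Finset.sum_congr rfl fun i _ => ?_
  rw [appLE_add]
  exact appLE_add _ _ _ _

/-- The contraction in a frame is `𝒪_X(W)`-linear in `B`. [folklore] -/
lemma frameContract_smul (a : Γ(X, W)) (B : E.over W ⟶ (sheafHom (dual E) G).over W) :
    frameContract G e (a • B) = a • frameContract G e B := by
  unfold frameContract
  rw [Finset.smul_sum]
  refine Finset.sum_congr rfl fun i _ => ?_
  rw [appLE_smul_id]
  exact appLE_smul_id a _ _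

omit [Fintype I] in
/-- `Φ ↦ Φ(λ)` is additive (finite sums), for `Φ ∈ Hom(E^∨|_W, G|_W)`. [folklore] -/
lemma appLE_sum_smul_left {ι : Type*} (t : Finset ι) (c : ι → Γ(X, W))
    (Φ : ι → ((dual E).over W ⟶ G.over W)) (μ : E.over W ⟶ (unitModule X).over W) :
    appLE (∑ j ∈ t, c j • Φ j) (𝟙 W) (μ : Γ(dual E, W)) = ∑ j ∈ t, c j • appLE (Φ j) (𝟙 W) μ := by
  rw [appLE_sum]
  exact Finset.sum_congr rfl fun j _ => appLE_smul_id (c j) (Φ j) _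

omit [Fintype I] in
/-- `λ ↦ Φ(λ)` is `𝒪(W)`-linear (finite sums), for `Φ ∈ Hom(E^∨|_W, G|_W)`. [folklore] -/
lemma appLE_sum_smul_right {ι : Type*} (t : Finset ι) (c : ι → Γ(X, W))
    (Φ : (dual E).over W ⟶ G.over W) (μ : ι → (E.over W ⟶ (unitModule X).over W)) :
    appLE Φ (𝟙 W) ((∑ j ∈ t, c j • μ j : E.over W ⟶ (unitModule X).over W) : Γ(dual E, W)) =
      ∑ j ∈ t, c j • appLE Φ (𝟙 W) (μ j : Γ(dual E, W)) := by
  exact (appLE_sum_right t Φ (𝟙 W) (fun j => ((c j • μ j : E.over W ⟶ (unitModule X).over W) :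
    Γ(dual E, W)))).trans (Finset.sum_congr rfl fun j _ => appLE_smul_right Φ (𝟙 W) (c j) (μ j))

/-- **Frame independence of the contraction**: two trivialisations of `E|_W` give the same
`∑_i B(b_i)(λ_i)` (expand one basis in the other; `tr(PQ) = tr(QP)`). [folklore] -/
theorem frameContract_eq (e' : SheafOfModules.free I' ≅ E.over W) [Fintype I']
    (B : E.over W ⟶ (sheafHom (dual E) G).over W) :
    frameContract G e B = frameContract G e' B := by
  -- the second frame, its dual basis and the values of `B` on it
  set b' : I' → Γ(E, W) := basisSection e' with hb'
  set Φ' : I' → ((dual E).over W ⟶ G.over W) := fun j =>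
    (appLE B (𝟙 W) (b' j) : (dual E).over W ⟶ G.over W) with hΦ'
  -- expand `B(b_i)` in the frame `e'`
  have hB : ∀ i, (appLE B (𝟙 W) (basisSection e i) : (dual E).over W ⟶ G.over W) =
      ∑ j, coord e' (𝟙 W) (basisSection e i) j • Φ' j := by
    intro i
    have h := appLE_eq_sum_coord e' B (𝟙 W) (basisSection e i)
    simp only [presheaf_map_id] at h
    exact h
  -- expand `λ'_j` in the dual frame of `e`
  have hμ : ∀ j, (dualBasis e' j : E.over W ⟶ (unitModule X).over W) =
      ∑ i, coord e' (𝟙 W) (basisSection e i) j • dualBasis e i := fun j =>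
    eq_sum_smul_dualBasis e (dualBasis e' j)
  calc frameContract G e B
      = ∑ i, ∑ j, coord e' (𝟙 W) (basisSection e i) j • appLE (Φ' j) (𝟙 W)
          (dualBasis e i : E.over W ⟶ (unitModule X).over W) := by
        unfold frameContract
        refine Finset.sum_congr rfl fun i _ => ?_
        rw [hB i, appLE_sum_smul_left]
    _ = ∑ j, ∑ i, coord e' (𝟙 W) (basisSection e i) j • appLE (Φ' j) (𝟙 W)
          (dualBasis e i : E.over W ⟶ (unitModule X).over W) := Finset.sum_comm
    _ = ∑ j, appLE (Φ' j) (𝟙 W) (dualBasis e' j : E.over W ⟶ (unitModule X).over W) := by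
        refine Finset.sum_congr rfl fun j _ => ?_
        rw [hμ j, appLE_sum_smul_right]
    _ = frameContract G e' B := rfl

/-- **The contraction in a frame is compatible with restriction** (to the restricted frame).
[folklore] -/
theorem map_frameContract (k : V ⟶ W) (B : E.over W ⟶ (sheafHom (dual E) G).over W) :
    G.presheaf.map k.op (frameContract G e B) =
      frameContract G (SheafOfModules.restrictTrivialisation (R := X.ringCatSheaf) k e)
        (restrictHom k B) := by
  unfold frameContract
  rw [map_sum]
  refine Finset.sum_congr rfl fun i _ => ?_
  rw [← restrictHom_dualBasis, basisSection_restrictTrivialisation, appLE_restrictHom,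
    Subsingleton.elim (𝟙 V ≫ k) (k ≫ 𝟙 W), appLE_map B (𝟙 W) k]
  change _ = appLE (restrictHom k (appLE B (𝟙 W) (basisSection e i) : (dual E).over W ⟶ G.over W))
    (𝟙 V) ((dual E).presheaf.map k.op (dualBasis e i : E.over W ⟶ (unitModule X).over W))
  rw [appLE_restrictHom, Subsingleton.elim (𝟙 V ≫ k) (k ≫ 𝟙 W), appLE_map]

end FrameContract

end Literature.AlgebraicGeometry.Modules

end
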